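import Summits.ValiantsHypothesis.ValiantsHypothesis.Theorems.SuccinctLiftSmlAnyField
import Summits.ValiantsHypothesis.ValiantsHypothesis.Theorems.DepthWindowBDSSlope

/-!
# SuccinctLift — general circuits over ANY field up to slope `18/25` (Forbes × Bhargav–Dutta–Saxena)

Support file for wall D of `route-ValiantsHypothesis-SuccinctLift` (stmt-ValiantsHypothesis-23721,
census cell W34 «2-non-unit cut», whose VP-internal leaf lives over `𝔽̄₂`).
`SuccinctLiftSmlAnyField.immHard_anyField` runs Forbes' characteristic-free low-depth
set-multilinearisation into the LST engine `DepthWindow.homImmHard_core` (homogeneous slope `< 1`,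
hence general slope `< 1/2`).  The tree also holds the sharper Bhargav–Dutta–Saxena kernel
`DepthWindow.BDS.homBds`, typed over ANY field, whose homogeneous window is every slope `≤ 36/25`
(`DepthWindow.homBds_core_gen` + `DepthWindow.BDS.fit_slope`, stated over `ℂ`).  This file re-types
that kernel over a field `K` (`homBds_coreK`, proof verbatim) and feeds it the set-multilinearised
circuit: `immHard_anyField_bds` — for every field `K` and every slope `p/q ≤ 18/25`, general circuits
of product depth `⌊p·L₃(m)/q⌋ + c` for `IMM_{m,⌊√log₂ m⌋}` have `> m^c + c` wires for all large `m`.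
The consumer `SuccinctLiftSmlAnyFieldDetBDS` turns this into the determinant / permanent dial over
every field and the W34 leaf over `𝔽̄₂` at every slope `≤ 18/25`.

References: Forbes2024LowDepth (CCC 2024, Thm. 1, §1.2); BhargavDuttaSaxena2024 (Thm. 1.4, Rem. 1.5,
Lemma 4.3); LimayeSrinivasanTavenas2025 (Lemma 12, Cor. 4).
-/

noncomputable section

open MvPolynomial

-- the summit and the problem share the name `ValiantsHypothesis` (D-0017 single-conjunct layout)
set_option linter.dupNamespace false

namespace Summit.ValiantsHypothesis.ValiantsHypothesis.Theorems.SuccinctLiftSmlAnyFieldBDS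

open Literature.Computability.AlgebraicComplexity ArithCircuit
open SuccinctLiftSmlCircuit SuccinctLiftSmlAnyField DepthWindow

universe u

/-! ### The BDS kernel over any field -/

/-- **The Bhargav–Dutta–Saxena kernel with a free depth parameter, over ANY field** — the statement of
`DepthWindow.homBds_core_gen` with `ℂ` replaced by a field `K`; its proof is already field-generic
(`DepthWindow.BDS.homBds` is typed over any field), so this is a verbatim re-typing.  With `L = ⌊log₂ m⌋`,
`d = ⌊√L⌋` and any `Δ ≥ 2` satisfying the fit `(256(c+2)Δ)^{F_{Δ+2}} ≤ ⌊√L⌋`, `4⌊√L⌋ ≤ L`, a circuit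
with homogeneous gate values, of product depth `≤ Δ`, computing `IMM_{m,d}` over `K` has `> m^c + c`
gates. [cite: BhargavDuttaSaxena2024, Thm. 1.4, Rem. 1.5] [cite: Forbes2024LowDepth, §1.2] -/
theorem homBds_coreK (K : Type u) [Field K] (c Δ m : ℕ) {d L : ℕ} (hL : L = Nat.log 2 m)
    (hd : d = Nat.sqrt L) (hΔ2 : 2 ≤ Δ)
    (hfit : (256 * (c + 2) * Δ) ^ Nat.fib (Δ + 2) ≤ Nat.sqrt L) (h4 : 4 * Nat.sqrt L ≤ L)
    (D : ArithCircuit K (Fin d × Fin m × Fin m))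
    (hhom : ∀ v ∈ ArithCircuit.gateValues D.gates, ∃ e : ℕ, v.IsHomogeneous e)
    (hD : D.Computes (immPoly m d K)) (hpd : D.productDepth ≤ Δ) :
    m ^ c + c < D.size := by
  set lam := 256 * (c + 2) * Δ with hlam
  have hlam32 : 32 ≤ lam := by rw [hlam]; nlinarith
  have hdd : d * d ≤ L := by rw [hd]; exact Nat.sqrt_le L
  have hd4 : 4 * d ≤ L := by rw [hd]; exact h4
  have hd1 : 1 ≤ d := by
    have h1 : 1 ≤ lam ^ Nat.fib (Δ + 2) := Nat.one_le_pow _ _ (by omega)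
    rw [hd]; omega
  have hL4 : 4 ≤ L := by omega
  have hfit' : lam ^ Nat.fib (Δ + 2) ≤ lam * d := by
    calc lam ^ Nat.fib (Δ + 2) ≤ d := by rw [hd]; exact hfit
      _ ≤ lam * d := Nat.le_mul_of_pos_left d (by omega)
  have hdn : 4 * d ≤ Nat.log 2 m := hL ▸ hd4
  have h := BDS.homBds K (Δ := Δ) (by omega) m d lam hd1 hlam32 hfit' hdn D hpd hhom hD
  rw [← hL] at h
  have hE1 : 1 ≤ 2 * (c + 2) * Δ := by nlinarith
  have hexp : ((((2 * (c + 2) * Δ - 1) * L : ℕ)) : ℝ) ≤ (L : ℝ) * ((lam : ℝ) - 32) / 128 := by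
    have hlamR : (lam : ℝ) = 256 * ((c : ℝ) + 2) * Δ := by rw [hlam]; push_cast; ring
    have hLR : (0 : ℝ) ≤ L := Nat.cast_nonneg _
    push_cast [Nat.cast_sub hE1]
    rw [hlamR]
    nlinarith [hLR]
  have hN : 2 ^ ((2 * (c + 2) * Δ - 1) * L) ≤ (D.size * d ^ d + 1) ^ Δ := by
    have h1 := (Real.rpow_le_rpow_of_exponent_le one_le_two hexp).trans h
    rw [Real.rpow_natCast] at h1
    exact_mod_cast h1
  by_contra hs
  push Not at hs
  have hm2 : m < 2 ^ (L + 1) := by rw [hL]; exact Nat.lt_pow_succ_log_self one_lt_two m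
  have hmc : m ^ c ≤ 2 ^ ((L + 1) * c) := by
    rw [pow_mul]; exact Nat.pow_le_pow_left hm2.le c
  have hmcc : m ^ c + c ≤ 2 ^ ((L + 1) * c + c) := by
    have h1 : c + 1 ≤ 2 ^ c := Nat.lt_two_pow_self
    have h2 : 1 ≤ 2 ^ ((L + 1) * c) := Nat.one_le_two_pow
    calc m ^ c + c ≤ 2 ^ ((L + 1) * c) + 2 ^ ((L + 1) * c) * c := by nlinarith
      _ = 2 ^ ((L + 1) * c) * (c + 1) := by ring
      _ ≤ 2 ^ ((L + 1) * c) * 2 ^ c := Nat.mul_le_mul_left _ h1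
      _ = 2 ^ ((L + 1) * c + c) := by rw [← pow_add]
  have hddL : d ^ d ≤ 2 ^ L := by
    calc d ^ d ≤ (2 ^ d) ^ d := Nat.pow_le_pow_left (Nat.lt_two_pow_self).le d
      _ = 2 ^ (d * d) := by rw [← pow_mul]
      _ ≤ 2 ^ L := Nat.pow_le_pow_right (by norm_num) hdd
  have hup : D.size * d ^ d + 1 ≤ 2 ^ ((L + 1) * c + c + L + 1) := by
    have h1 : D.size * d ^ d ≤ 2 ^ ((L + 1) * c + c + L) := by
      rw [pow_add]; exact Nat.mul_le_mul (hs.trans hmcc) hddL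
    have h2 : 1 ≤ 2 ^ ((L + 1) * c + c + L) := Nat.one_le_two_pow
    rw [pow_succ]; omega
  have hupΔ : (D.size * d ^ d + 1) ^ Δ ≤ 2 ^ (((L + 1) * c + c + L + 1) * Δ) := by
    rw [pow_mul]; exact Nat.pow_le_pow_left hup Δ
  have hfin := (Nat.pow_le_pow_iff_right (by norm_num)).1 (hN.trans hupΔ)
  zify [hE1] at hfin
  have hcZ : (0 : ℤ) ≤ c := by exact_mod_cast Nat.zero_le c
  have hΔZ : (2 : ℤ) ≤ Δ := by exact_mod_cast hΔ2
  have hLZ : (4 : ℤ) ≤ L := by exact_mod_cast hL4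
  nlinarith [mul_nonneg (mul_nonneg hcZ (by linarith : (0 : ℤ) ≤ Δ)) (by linarith : (0 : ℤ) ≤ (L : ℤ) - 2),
    mul_nonneg (by linarith : (0 : ℤ) ≤ (Δ : ℤ) - 2) (by linarith : (0 : ℤ) ≤ 3 * (L : ℤ) - 1)]

/-! ### General circuits over any field, every slope `≤ 18/25` -/

/-- **Limaye–Srinivasan–Tavenas / Bhargav–Dutta–Saxena over ANY field, GENERAL circuits, every slope
`σ ≤ 18/25`.**  For every field `K`, `25 p ≤ 18 q` and every `c`: for all large `m`, every circuit over
`K` (no homogeneity assumption) computing `IMM_{m,⌊√log₂ m⌋}` in product depth `≤ ⌊p·L₃(m)/q⌋ + c`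
has `> m^c + c` wires.  Route: normalise (`exists_size_le_edgeSize`), set-multilinearise at low depth
(`SuccinctLiftSmlCircuit.exists_sml_circuit`, Forbes: depth `× 2`, size `× γ(d) ≤ m²`, all gate values
homogeneous — valid in every characteristic), then the field-generic BDS kernel `homBds_coreK` at the
doubled slope `2p/q ≤ 36/25` past the fit `DepthWindow.BDS.fit_slope`.  This is the window the tree
holds over `ℂ` for general circuits (`DepthWindow.immHardAt_of_le_18_25`), now characteristic-free.
[cite: Forbes2024LowDepth, Thm. 1, §1.2] [cite: BhargavDuttaSaxena2024, Thm. 1.4, Rem. 1.5]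
[cite: LimayeSrinivasanTavenas2025, Cor. 4] -/
theorem immHard_anyField_bds (K : Type u) [Field K] {p q : ℕ} (hpq : 25 * p ≤ 18 * q) (c : ℕ) :
    ∃ m₁ : ℕ, ∀ m : ℕ, m₁ ≤ m →
      ∀ D : ArithCircuit K (Fin (Nat.sqrt (Nat.log 2 m)) × Fin m × Fin m),
        D.Computes (immPoly m (Nat.sqrt (Nat.log 2 m)) K) →
        D.productDepth ≤ p * Nat.log 2 (Nat.log 2 (Nat.log 2 m)) / q + c → m ^ c + c < D.edgeSize := by
  rcases Nat.eq_zero_or_pos p with rfl | hp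
  · -- slope `0` (constant additive depth): already `immHard_anyField` at `p = 0`, `q = 1`
    obtain ⟨m₁, hm₁⟩ := immHard_anyField K (p := 0) (q := 1) (by norm_num) c
    refine ⟨m₁, fun m hm D hD hpd => hm₁ m hm D hD ?_⟩
    simpa using hpd
  have hq : 0 < q := by omega
  obtain ⟨L₀, hL₀⟩ := BDS.fit_slope (2 * p) q (2 * c + 3) (by omega) hq (by omega)
  refine ⟨2 ^ max L₀ 100 + (2 * c + 2), fun m hm D hD hpd => ?_⟩
  have hm' : 2 ^ max L₀ 100 ≤ m := le_trans (Nat.le_add_right _ _) hm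
  have hmc : 2 * c + 2 ≤ m := le_trans (Nat.le_add_left _ _) hm
  have h100 : 2 ^ 100 ≤ m := le_trans (Nat.pow_le_pow_right (by norm_num) (le_max_right _ _)) hm'
  have hm0 : m ≠ 0 := by omega
  have hL100 : 100 ≤ Nat.log 2 m := Nat.le_log_of_pow_le (by norm_num) h100
  have h2L : 2 ^ Nat.log 2 m ≤ m := Nat.pow_log_le_self 2 hm0
  by_contra hle
  push Not at hle
  obtain ⟨D', hD'e, hD'd, hD'w, hD's⟩ := exists_size_le_edgeSize D
  obtain ⟨H, hH, hhom, hHpd, hHsize, -⟩ :=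
    exists_sml_circuit (Prod.fst : Fin (Nat.sqrt (Nat.log 2 m)) × Fin m × Fin m → Fin _) D'
  have hHc : H.Computes (immPoly m (Nat.sqrt (Nat.log 2 m)) K) := by
    rw [Computes, hH, hD'e, show D.eval = immPoly m _ K from hD,
      IsSetMultilinear.smlProj_eq _ (isSetMultilinear_immPoly K m _)]
  have hHpd' : H.productDepth ≤ 2 * p * Nat.log 2 (Nat.log 2 (Nat.log 2 m)) / q + (2 * c + 3) := by
    have h1 : 2 * (p * Nat.log 2 (Nat.log 2 (Nat.log 2 m)) / q) ≤
        2 * p * Nat.log 2 (Nat.log 2 (Nat.log 2 m)) / q := by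
      rw [mul_assoc]; exact Nat.mul_div_le_mul_div_assoc _ _ _
    calc H.productDepth ≤ 2 * D'.productDepth := hHpd
      _ ≤ 2 * D.productDepth := Nat.mul_le_mul_left 2 hD'd
      _ ≤ 2 * (p * Nat.log 2 (Nat.log 2 (Nat.log 2 m)) / q + c) := Nat.mul_le_mul_left 2 hpd
      _ = 2 * (p * Nat.log 2 (Nat.log 2 (Nat.log 2 m)) / q) + 2 * c := by rw [mul_add]
      _ ≤ _ := add_le_add h1 (by omega)
  have hLge : L₀ ≤ Nat.log 2 m :=
    le_trans (le_max_left _ _) (Nat.le_log_of_pow_le (by norm_num) hm')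
  obtain ⟨hΔ2, hfit, h4⟩ := hL₀ (Nat.log 2 m) hLge
  have hcore := homBds_coreK K (2 * c + 3) _ m rfl rfl hΔ2 hfit h4 H hhom hHc hHpd'
  have hγ : gamma (Nat.sqrt (Nat.log 2 m)) ≤ m * m :=
    (gamma_le (Nat.log 2 m) _ rfl hL100).trans (Nat.mul_le_mul h2L h2L)
  have hDD : D'.edgeSize + D'.size ≤ 2 * (m ^ c + c) := by omega
  have hsz : H.size ≤ 2 * (m ^ c + c) * (m * m) := hHsize.trans (Nat.mul_le_mul hDD hγ)
  have hm1 : 1 ≤ m := by omega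
  have hmc1 : 1 ≤ m ^ c := Nat.one_le_pow _ _ hm1
  have e1 : c * (m * m) ≤ c * m ^ c * (m * m) := by
    have h1 : c * 1 ≤ c * m ^ c := Nat.mul_le_mul_left c hmc1
    rw [mul_one] at h1
    exact Nat.mul_le_mul_right _ h1
  have hfin : 2 * (m ^ c + c) * (m * m) ≤ m ^ (2 * c + 3) + (2 * c + 3) := by
    calc 2 * (m ^ c + c) * (m * m) = 2 * m ^ c * (m * m) + 2 * (c * (m * m)) := by ring
      _ ≤ 2 * m ^ c * (m * m) + 2 * (c * m ^ c * (m * m)) :=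
          Nat.add_le_add_left (Nat.mul_le_mul_left 2 e1) _
      _ = (2 + 2 * c) * m ^ c * (m * m) := by ring
      _ ≤ m * m ^ c * (m * m) := Nat.mul_le_mul_right _ (Nat.mul_le_mul_right _ (by omega))
      _ = m ^ (c + 3) := by ring
      _ ≤ m ^ (2 * c + 3) := Nat.pow_le_pow_right hm1 (by omega)
      _ ≤ _ := Nat.le_add_right _ _
  omega

end Summit.ValiantsHypothesis.ValiantsHypothesis.Theorems.SuccinctLiftSmlAnyFieldBDS
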